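import Literature.Geometry.Kaehler.StrataDDbarDescent
import Literature.Geometry.Manifold.StrataNbhdTautnessComplex
import Literature.Geometry.Kaehler.ManifoldFormsPullback
import Literature.Geometry.Kaehler.MayerVietoris
import Literature.Geometry.Kaehler.ConnectionExists
import HarnessLib

/-!
# Descent of the strata `∂∂̄`-cochain to a neighbourhood of the configuration

Topic `Literature/Geometry/Kaehler`. Brick [C₂] of the direct route to P. Deligne's Cor. 8.2.8
of *Théorie de Hodge III* on the tree's compact Kähler carriers (programme recorded in
`Literature/AlgebraicGeometry/HodgeTheory/GysinKernelSplitRationalCore.lean`): the strata cochain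
`η` of `StrataDDbarDescent` (forms on the abstract strata `P I`, `d η₀ = x|`,
`δ η_a ± d η_{a+1} = 0`) is transported to honest de Rham–Čech data on OPEN NEIGHBOURHOODS of
the images `emb (P I) ⊆ M`, level by level, using the tautness statements of
`StrataNbhdTautnessComplex` (T1: a closed form near `emb (P_J)` whose pull-back to `P_J` is
exact is exact on a smaller neighbourhood; T2: every closed form on `P_J` is, up to an exact
form, the pull-back of a closed form on a neighbourhood). This is the classical comparison of
the Mayer–Vietoris (Čech) spectral sequence of a closed cover by submanifolds with that of a
system of neighbourhoods (R. Bott, L. Tu (1982), §8 and Prop. 8.8; tautness: G. Bredon (1997),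
II.10.6, E. Spanier (1966), 6.1.10), made effective: no neighbourhood is ever required to
retract onto a stratum.

## Main result

`StrataMaps.exists_nbhd_descent`: given a strata system `T` with embeddings `emb`, compact
Hausdorff second-countable strata and ambient manifold, a smooth closed complex `(k+2)`-form `x`
on `M` and strata cochains `η a b` (smooth, `d η_{(i)} = x|_{P (i)}`,
`δ η_a + (-1)^{a+1} d η_{a+1} = 0` on `a + b = k`, `η_a = 0` in form-degree `0`), there are
open sets `N n J ⊇ emb (P_J)` for all tuples `J` of length `n + 1 ≤ k + 3`, decreasing along
faces, and forms `γ n J` smooth on `N n J` of degree `k + 1 - n`, with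
`d γ_{(i)} = x` on `N 0 (i)`, `δ γ_n + (-1)^{n+1} d γ_{n+1} = 0` on `N (n+1) J`, and
`δ γ_{k+1} = 0` on `N (k+2) J` — i.e. `x` is a coboundary in the Čech–de Rham complex of the
system of neighbourhoods (assembled on an honest open cover in
`Literature/Geometry/Kaehler/StrataNbhdCechAssembly.lean`).

## Proof

Induction on the level `n` (§3), carrying opens `N_n`, ambient cochains `γ_n` and strata
cochains `κ_n` with the invariant `δ(emb^* γ_n - η_n - (-1)^n d κ_n) = 0`: the Čech
coboundary `c = δ γ_n` is closed near `emb (P_J)` with `emb^* c = d λ` explicitly, so T1 makes it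
exact (`γ'`); the defect `emb^* γ' - η_{n+1} - δ κ_n` is closed on `P_J`, so T2 corrects `γ'`
by a closed form and produces `κ_{n+1}`. §1: the ambient Čech differential `cdelta` on tuples
and its calculus; §2: the step and its unconditional properties; §3: the invariants; §4: level
`0`, the last level and the export. Everything is proved; no named facts (D-0026).

## References

* R. Bott, L. W. Tu, *Differential Forms in Algebraic Topology*, Springer GTM 82 (1982), §8
  (the Čech–de Rham complex; Prop. 8.8) and §II.13. [BottTu1982Forms]
* G. E. Bredon, *Sheaf Theory*, 2nd ed., Springer GTM 170 (1997), §II.10 (taut subspaces). [Bredon1997]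
* E. H. Spanier, *Algebraic Topology* (1966), Ch. 6 §1, Thm. 10; §6.8–6.9. [Spanier1981]
* P. Deligne, *Théorie de Hodge III*, Publ. Math. IHÉS 44 (1974), 8.2.7–8.2.8. [DeligneHodgeIII1974]
* P. Deligne, Ph. Griffiths, J. Morgan, D. Sullivan, *Real homotopy theory of Kähler manifolds*,
  Invent. Math. 29 (1975), §5–§6. [DeligneGriffithsMorganSullivan1975]
-/

noncomputable section

open scoped Manifold ContDiff Topology
open Set Function Finset Literature.NumberTheory.Transcendental Literature.Geometry.Manifold
open _root_.Topology

universe u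

namespace Literature.Geometry.Kaehler

set_option backward.isDefEq.respectTransparency false

/-! ### §1 The ambient Čech differential on ordered tuples and its calculus -/

section Ambient

variable {ι : Type}
  {EM : Type u} [NormedAddCommGroup EM] [NormedSpace ℂ EM]
  {M : Type u} [TopologicalSpace M] [ChartedSpace EM M]

/-- `d (α - β) = dα - dβ` for smooth forms. [folklore] -/
theorem mextDeriv_sub' [IsManifold 𝓘(ℝ, EM) ∞ M] {b : ℕ} {α β : MForm 𝓘(ℝ, EM) M ℂ b} (hα : IsSmoothForm α)
    (hβ : IsSmoothForm β) : mextDeriv (α - β) = mextDeriv α - mextDeriv β := by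
  rw [sub_eq_add_neg, mextDeriv_add hα hβ.neg', mextDeriv_neg, ← sub_eq_add_neg]

variable (ι EM M) in
/-- **Ambient cochains** of Čech degree `n` and form degree `b`: a complex `b`-form on `M` for
every ordered `(n+1)`-tuple of indices (meant to be supported on an open set `N J` attached to
the tuple; Bott–Tu (1982), §8). [cite: BottTu1982Forms, §8 (8.1)] -/
abbrev MCochain (n b : ℕ) : Type u :=
  (Fin (n + 1) → ι) → MForm 𝓘(ℝ, EM) M ℂ b

/-- **The ambient Čech differential**, cut off to a set `S`:
`(δ_S c)_J = Σ_j (-1)^j (c_{J ∘ σ_j})|_S`, `σ_j = Fin.succAbove j` (the convention of the tree's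
`cechδ`, with the set made explicit). [cite: BottTu1982Forms, §8 (8.4)] -/
def cdelta {n b : ℕ} (S : Set M) (c : MCochain ι EM M n b) (J : Fin (n + 2) → ι) :
    MForm 𝓘(ℝ, EM) M ℂ b :=
  ∑ j : Fin (n + 2), (-1 : ℂ) ^ (j : ℕ) • (c (J ∘ Fin.succAbove j)).restr S

/-- `δ_S c` at a point of `S`. [folklore] -/
theorem cdelta_apply_of_mem {n b : ℕ} {S : Set M} (c : MCochain ι EM M n b) (J : Fin (n + 2) → ι)
    {y : M} (hy : y ∈ S) :
    cdelta S c J y = ∑ j : Fin (n + 2), (-1 : ℂ) ^ (j : ℕ) • c (J ∘ Fin.succAbove j) y := by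
  simp only [cdelta, Finset.sum_apply, Pi.smul_apply, MForm.restr_apply_of_mem _ hy]

/-- `δ_S c` vanishes off `S`. [folklore] -/
theorem cdelta_apply_of_notMem {n b : ℕ} {S : Set M} (c : MCochain ι EM M n b)
    (J : Fin (n + 2) → ι) {y : M} (hy : y ∉ S) : cdelta S c J y = 0 := by
  simp only [cdelta, Finset.sum_apply, Pi.smul_apply, MForm.restr_apply_of_notMem _ hy, smul_zero,
    sum_const_zero]

/-- `δ_S c = (δ_{S'} c)|_S` for `S ⊆ S'`. [folklore] -/
theorem cdelta_restr {n b : ℕ} {S S' : Set M} (hSS' : S ⊆ S') (c : MCochain ι EM M n b)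
    (J : Fin (n + 2) → ι) : (cdelta S' c J).restr S = cdelta S c J := by
  funext y
  by_cases hy : y ∈ S
  · rw [MForm.restr_apply_of_mem _ hy, cdelta_apply_of_mem c J hy, cdelta_apply_of_mem c J (hSS' hy)]
  · rw [MForm.restr_apply_of_notMem _ hy, cdelta_apply_of_notMem c J hy]

/-- `δ_S` of cochains smooth on opens `N J' ⊇ S` is smooth on the open set `S`. [folklore] -/
theorem cdelta_mem_smoothFormsOn {n b : ℕ} {S : Set M} (hS : IsOpen S) {N : (Fin (n + 1) → ι) → Set M}
    {c : MCochain ι EM M n b} (J : Fin (n + 2) → ι) (hSN : ∀ j, S ⊆ N (J ∘ Fin.succAbove j))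
    (hc : ∀ j, c (J ∘ Fin.succAbove j) ∈ smoothFormsOn 𝓘(ℝ, EM) ℂ (N (J ∘ Fin.succAbove j)) b) :
    cdelta S c J ∈ smoothFormsOn 𝓘(ℝ, EM) ℂ S b := by
  refine (smoothFormsOn 𝓘(ℝ, EM) ℂ S b).sum_mem fun j _ ↦ ?_
  exact smul_complex_mem_smoothFormsOn _ (restr_mem_smoothFormsOn hS (hSN j) (hc j))

/-- `d (δ_S c)` at a point of the open set `S` at which the faces are smooth. [folklore] -/
theorem mextDeriv_cdelta_apply [IsManifold 𝓘(ℝ, EM) ∞ M] {n b : ℕ} {S : Set M} (hS : IsOpen S) (c : MCochain ι EM M n b)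
    (J : Fin (n + 2) → ι) {y : M} (hy : y ∈ S) (hc : ∀ j, (c (J ∘ Fin.succAbove j)).SmoothAt y) :
    mextDeriv (cdelta S c J) y =
      ∑ j : Fin (n + 2), (-1 : ℂ) ^ (j : ℕ) • mextDeriv (c (J ∘ Fin.succAbove j)) y := by
  have hsm : ∀ j : Fin (n + 2),
      ((-1 : ℂ) ^ (j : ℕ) • (c (J ∘ Fin.succAbove j)).restr S).SmoothAt y := fun j ↦
    ((MForm.smoothAt_restr_iff hS _ hy).2 (hc j)).smul_complex _
  rw [cdelta, mextDeriv_finset_sum_apply fun j _ ↦ hsm j]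
  refine sum_congr rfl fun j _ ↦ ?_
  rw [mextDeriv_smul_complex_holds, Pi.smul_apply, mextDeriv_restr_apply hS _ hy]

/-- **`δ ∘ δ = 0` for the ambient Čech differential**, pointwise at a point lying in all the sets
involved (the double faces cancel in pairs,
`Literature.Algebra.Homology.CechTuple.sum_sum_neg_one_pow_smul_smul_faces_eq_zero`).
[cite: BottTu1982Forms, §8 (8.4)] -/
theorem cdelta_cdelta_apply {n b : ℕ} {S : Set M} {S₁ : (Fin (n + 2) → ι) → Set M}
    (c : MCochain ι EM M n b) (J : Fin (n + 3) → ι) {y : M} (hy : y ∈ S)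
    (hy₁ : ∀ i, y ∈ S₁ (J ∘ Fin.succAbove i)) :
    cdelta S (fun J' ↦ cdelta (S₁ J') c J') J y = 0 := by
  rw [cdelta_apply_of_mem _ J hy]
  have : ∀ i : Fin (n + 3), (-1 : ℂ) ^ (i : ℕ) • cdelta (S₁ (J ∘ Fin.succAbove i)) c
      (J ∘ Fin.succAbove i) y = ∑ j : Fin (n + 2), (-1 : ℂ) ^ (i : ℕ) • (-1 : ℂ) ^ (j : ℕ) •
        c (J ∘ (Fin.succAbove i ∘ Fin.succAbove j)) y := by
    intro i
    rw [cdelta_apply_of_mem _ _ (hy₁ i), smul_sum]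
    rfl
  simp_rw [this]
  exact Literature.Algebra.Homology.CechTuple.sum_sum_neg_one_pow_smul_smul_faces_eq_zero (R := ℂ)
    (fun θ ↦ c (J ∘ θ) y)

/-- A real scalar acts on complex forms through `ℝ → ℂ`. [folklore] -/
theorem real_smul_eq_complex_smul {b : ℕ} (r : ℝ) (α : MForm 𝓘(ℝ, EM) M ℂ b) :
    r • α = (r : ℂ) • α := by
  funext y; ext v; simp

/-- `(-1)^{n+1} (-1)^n = -1`. [folklore] -/
theorem neg_one_pow_succ_mul_neg_one_pow (n : ℕ) : (-1 : ℂ) ^ (n + 1) * (-1 : ℂ) ^ n = -1 := by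
  rw [← pow_add, show n + 1 + n = 2 * n + 1 by ring, pow_succ, pow_mul, neg_one_sq, one_pow, one_mul]

/-! #### Pull-backs of forms smooth on an open set along a map landing in it -/

variable {EP : Type u} [NormedAddCommGroup EP] [NormedSpace ℂ EP]
  {P : Type u} [TopologicalSpace P] [ChartedSpace EP P] [IsManifold 𝓘(ℝ, EP) ∞ P]

omit [IsManifold 𝓘(ℝ, EP) ∞ P] in
/-- Pull-back is compatible with subtraction. [folklore] -/
theorem MForm.pullback_sub' {b : ℕ} (f : P → M) (α β : MForm 𝓘(ℝ, EM) M ℂ b) :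
    (α - β).pullback 𝓘(ℝ, EP) f = α.pullback 𝓘(ℝ, EP) f - β.pullback 𝓘(ℝ, EP) f := by
  funext y; ext v; simp [MForm.pullback_apply]

/-- The pull-back of a form smooth on an open set `V` along a `C^∞` map landing in `V` is smooth.
[folklore] -/
theorem isSmoothForm_pullback_of_mem_smoothFormsOn [IsManifold 𝓘(ℝ, EM) ∞ M] {b : ℕ} {V : Set M} {g : MForm 𝓘(ℝ, EM) M ℂ b}
    (hg : g ∈ smoothFormsOn 𝓘(ℝ, EM) ℂ V b) {f : P → M} (hf : ContMDiff 𝓘(ℝ, EP) 𝓘(ℝ, EM) ∞ f)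
    (hfV : ∀ y, f y ∈ V) : IsSmoothForm (g.pullback 𝓘(ℝ, EP) f) :=
  (isSmoothForm_iff_smoothAt _).2 fun y ↦
    MForm.SmoothAt.pullback (Filter.Eventually.of_forall fun z ↦ hf z) (hg.1 _ (hfV y))

/-- `d` commutes with the pull-back of a form smooth on an open set `V` along a `C^∞` map landing
in `V`. [folklore] -/
theorem mextDeriv_pullback_of_mem_smoothFormsOn [IsManifold 𝓘(ℝ, EM) ∞ M] {b : ℕ} {V : Set M} {g : MForm 𝓘(ℝ, EM) M ℂ b}
    (hg : g ∈ smoothFormsOn 𝓘(ℝ, EM) ℂ V b) {f : P → M} (hf : ContMDiff 𝓘(ℝ, EP) 𝓘(ℝ, EM) ∞ f)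
    (hfV : ∀ y, f y ∈ V) :
    mextDeriv (g.pullback 𝓘(ℝ, EP) f) = (mextDeriv g).pullback 𝓘(ℝ, EP) f :=
  funext fun y ↦ mextDeriv_pullback_apply (Filter.Eventually.of_forall fun z ↦ hf z) (hg.1 _ (hfV y))

end Ambient

/-! ### §2 The descent step -/

section Descent

variable {ι : Type} [DecidableEq ι]
  {EM : Type u} [NormedAddCommGroup EM] [NormedSpace ℂ EM]
  {M : Type u} [TopologicalSpace M] [ChartedSpace EM M]
  {EP : Finset ι → Type u} [∀ I, NormedAddCommGroup (EP I)] [∀ I, NormedSpace ℂ (EP I)]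
  {P : Finset ι → Type u} [∀ I, TopologicalSpace (P I)] [∀ I, ChartedSpace (EP I) (P I)]

variable (EM M EP P) in
/-- **The data carried at level `n` of the descent**: an open set `N J` for every ordered
`(n+1)`-tuple `J`, ambient cochains `γ b` of all form degrees (meaningful in degree `k + 1 - n`,
junk elsewhere) and strata cochains `κ d` (the corrections produced by T2).
[cite: BottTu1982Forms, §8, Prop. 8.8] -/
structure LevelData (n : ℕ) where
  /-- The open neighbourhoods of the strata `emb (P_J)`, `J` of length `n + 1`. -/
  N : (Fin (n + 1) → ι) → Set M
  /-- The ambient Čech–de Rham cochains of level `n`, all form degrees. -/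
  γ : (b : ℕ) → MCochain ι EM M n b
  /-- The strata corrections of level `n`, all form degrees. -/
  κ : (d : ℕ) → SCochain EP P n d

/-- The intersection of the level-`n` neighbourhoods of the faces of an `(n+2)`-tuple. [folklore] -/
def LevelData.W {n : ℕ} (st : LevelData EM M EP P n) (J : Fin (n + 2) → ι) : Set M :=
  ⋂ j : Fin (n + 2), st.N (J ∘ Fin.succAbove j)

namespace StrataMaps

variable (T : StrataMaps (EM := EM) M EP P) (η : (a b : ℕ) → SCochain EP P a b) (k : ℕ)

/-- Pull-back of an ambient form to the stratum of a tuple, `emb_J^* α`. [cite: BottTu1982Forms, §8 (8.5)] -/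
def srho {n b : ℕ} (α : MForm 𝓘(ℝ, EM) M ℂ b) (J : Fin (n + 1) → ι) :
    MForm 𝓘(ℝ, EP (tupleSupport J)) (P (tupleSupport J)) ℂ b :=
  α.pullback 𝓘(ℝ, EP (tupleSupport J)) (T.emb (tupleSupport J))

/-- `emb_J` lands in every set containing the image of a face stratum: `emb_J = emb_{J∘σ} ∘ res`.
[folklore] -/
theorem emb_mem_of_face {n : ℕ} {N : (Fin (n + 1) → ι) → Set M} (J : Fin (n + 2) → ι)
    (j : Fin (n + 2)) (hN : ∀ y, T.emb (tupleSupport (J ∘ Fin.succAbove j)) y ∈ N (J ∘ Fin.succAbove j))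
    (y : P (tupleSupport J)) : T.emb (tupleSupport J) y ∈ N (J ∘ Fin.succAbove j) := by
  have := congrFun (T.emb_comp_res (tupleSupport_comp_subset J (Fin.succAbove j))) y
  rw [Function.comp_apply] at this
  rw [← this]
  exact hN _

/-- **`emb^*` intertwines the ambient and the strata Čech differentials**:
`emb_J^*(δ_S c)_J = (δ (emb^* c))_J` when `emb_J` lands in `S`. [cite: BottTu1982Forms, §8 (8.5)] -/
theorem srho_cdelta {n b : ℕ} {S : Set M} (c : MCochain ι EM M n b) (J : Fin (n + 2) → ι)
    (hS : ∀ y, T.emb (tupleSupport J) y ∈ S) :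
    T.srho (cdelta S c J) J = T.delta (fun J' ↦ T.srho (c J') J') J := by
  rw [srho, cdelta, pullback_sum, delta_apply]
  refine sum_congr rfl fun j _ ↦ ?_
  rw [pullback_csmul, MForm.pullback_restr_of_forall_mem hS, srho,
    ← MForm.pullback_comp ((T.contMDiff_emb _).mdifferentiable (by simp))
      ((T.contMDiff_res _).mdifferentiable (by simp)), T.emb_comp_res]

/-- `emb_J` lands in `W_J` when every `emb_{J'}` lands in `N J'`. [folklore] -/
theorem emb_mem_W {n : ℕ} {st : LevelData EM M EP P n}
    (hN : ∀ J' y, T.emb (tupleSupport J') y ∈ st.N J') (J : Fin (n + 2) → ι)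
    (y : P (tupleSupport J)) : T.emb (tupleSupport J) y ∈ st.W J :=
  mem_iInter.2 fun j ↦ T.emb_mem_of_face J j (hN _) y

variable [FiniteDimensional ℂ EM] [IsManifold 𝓘(ℝ, EM) ∞ M] [CompactSpace M] [T2Space M]
  [SecondCountableTopology M] [∀ I, FiniteDimensional ℂ (EP I)] [∀ I, IsManifold 𝓘(ℝ, EP I) ∞ (P I)]
  [∀ I, CompactSpace (P I)] [∀ I, T2Space (P I)] [∀ I, SecondCountableTopology (P I)]

/-- `d` of the strata corrections, shifted to the form degree in which it acts (`0` in degree `0`).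
[folklore] -/
def kapD {n : ℕ} (κ : (d : ℕ) → SCochain EP P n d) : (b : ℕ) → SCochain EP P n b
  | 0 => 0
  | d + 1 => fun J ↦ mextDeriv (κ d J)

/-- The explicit primitive of `emb_J^*(δ γ_n)_J` at the next level:
`λ¹_J = (-1)^n (η_{n+1,J} + (δ κ_n)_J)`. [cite: BottTu1982Forms, Prop. 8.8] -/
def lam1 {n : ℕ} (st : LevelData EM M EP P n) (b : ℕ) (J : Fin (n + 2) → ι) :
    MForm 𝓘(ℝ, EP (tupleSupport J)) (P (tupleSupport J)) ℂ b :=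
  (-1 : ℂ) ^ n • (η (n + 1) b J + T.delta (st.κ b) J)

/-- The hypotheses under which T1 is invoked at level `n + 1`, tuple `J`, form degree `b`.
[cite: Bredon1997, II.10.6] -/
def T1Hyp {n : ℕ} (st : LevelData EM M EP P n) (b : ℕ) (J : Fin (n + 2) → ι) : Prop :=
  IsEmbedding (T.emb (tupleSupport J)) ∧ IsOpen (st.W J) ∧ (∀ y, T.emb (tupleSupport J) y ∈ st.W J) ∧
    cdelta (st.W J) (st.γ (b + 1)) J ∈ localClosedForms 𝓘(ℝ, EM) ℂ (b + 1) (st.W J) ∧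
    IsSmoothForm (T.lam1 η st b J) ∧
    T.srho (cdelta (st.W J) (st.γ (b + 1)) J) J = mextDeriv (T.lam1 η st b J)

variable {T η} in
/-- T1 at level `n + 1`: `(δ γ_n)_J` is exact on a neighbourhood of `emb (P_J)`.
[cite: Bredon1997, II.10.6] [cite: Spanier1981, Ch. 6 §1, Thm. 10] -/
theorem T1Hyp.exists {n : ℕ} {st : LevelData EM M EP P n} {b : ℕ} {J : Fin (n + 2) → ι}
    (h : T.T1Hyp η st b J) :
    ∃ (V : Set M) (g : MForm 𝓘(ℝ, EM) M ℂ b), IsOpen V ∧ V ⊆ st.W J ∧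
      (∀ y, T.emb (tupleSupport J) y ∈ V) ∧ g ∈ smoothFormsOn 𝓘(ℝ, EM) ℂ V b ∧
      (mextDeriv g).restr V = (cdelta (st.W J) (st.γ (b + 1)) J).restr V := by
  obtain ⟨he, hW, hWf, hc, hl, hd⟩ := h
  obtain ⟨V, hV, hVW, hfV, hex⟩ :=
    exists_nhd_restr_mem_localExactForms_of_pullback_eq_mextDeriv_complex (T.contMDiff_emb _) he hW
      hWf hc hl hd
  obtain ⟨β, hβ⟩ := (mem_localExactForms_succ_iff hV).1 hex
  exact ⟨V, β, hV, hVW, fun y ↦ hfV (mem_range_self y), β.2, by rw [← hβ, coe_localD]⟩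

open Classical in
/-- The neighbourhood produced by T1 (or `W_J` if T1 does not apply). [folklore] -/
def V1 {n : ℕ} (st : LevelData EM M EP P n) (b : ℕ) (J : Fin (n + 2) → ι) : Set M :=
  if h : T.T1Hyp η st b J then h.exists.choose else st.W J

open Classical in
/-- The primitive produced by T1 (or `0`). [folklore] -/
def g1 {n : ℕ} (st : LevelData EM M EP P n) (b : ℕ) (J : Fin (n + 2) → ι) : MForm 𝓘(ℝ, EM) M ℂ b :=
  if h : T.T1Hyp η st b J then h.exists.choose_spec.choose else 0

/-- The defining properties of `V1`, `g1` when T1 applies. [folklore] -/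
theorem V1_spec {n : ℕ} {st : LevelData EM M EP P n} {b : ℕ} {J : Fin (n + 2) → ι}
    (h : T.T1Hyp η st b J) :
    IsOpen (T.V1 η st b J) ∧ T.V1 η st b J ⊆ st.W J ∧ (∀ y, T.emb (tupleSupport J) y ∈ T.V1 η st b J) ∧
      T.g1 η st b J ∈ smoothFormsOn 𝓘(ℝ, EM) ℂ (T.V1 η st b J) b ∧
      (mextDeriv (T.g1 η st b J)).restr (T.V1 η st b J) =
        (cdelta (st.W J) (st.γ (b + 1)) J).restr (T.V1 η st b J) := by
  simp only [V1, g1, dif_pos h]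
  exact h.exists.choose_spec.choose_spec

/-- `V1`, `g1` when T1 does not apply. [folklore] -/
theorem V1_of_not {n : ℕ} {st : LevelData EM M EP P n} {b : ℕ} {J : Fin (n + 2) → ι}
    (h : ¬T.T1Hyp η st b J) : T.V1 η st b J = st.W J ∧ T.g1 η st b J = 0 := by
  simp only [V1, g1, dif_neg h, and_self]

/-- **The defect** `λ²_J = emb_J^*((-1)^n g_J) - η_{n+1,J} - (δ κ_n)_J` (closed on `P_J`).
[cite: BottTu1982Forms, Prop. 8.8] -/
def lam2 {n : ℕ} (st : LevelData EM M EP P n) (b : ℕ) (J : Fin (n + 2) → ι) :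
    MForm 𝓘(ℝ, EP (tupleSupport J)) (P (tupleSupport J)) ℂ b :=
  T.srho ((-1 : ℂ) ^ n • T.g1 η st b J) J - η (n + 1) b J - T.delta (st.κ b) J

/-- The hypotheses under which T2 is invoked at level `n + 1`, tuple `J`, form degree `b`.
[cite: Bredon1997, II.10.6] -/
def T2Hyp {n : ℕ} (st : LevelData EM M EP P n) (b : ℕ) (J : Fin (n + 2) → ι) : Prop :=
  IsEmbedding (T.emb (tupleSupport J)) ∧ IsOpen (T.V1 η st b J) ∧
    (∀ y, T.emb (tupleSupport J) y ∈ T.V1 η st b J) ∧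
    T.lam2 η st b J ∈ closedSmoothForms 𝓘(ℝ, EP (tupleSupport J)) (P (tupleSupport J)) ℂ b

variable {T η} in
/-- T2 at level `n + 1`, positive form degree. [cite: Bredon1997, II.10.6] -/
theorem T2Hyp.exists_succ {n : ℕ} {st : LevelData EM M EP P n} {d : ℕ} {J : Fin (n + 2) → ι}
    (h : T.T2Hyp η st (d + 1) J) :
    ∃ (V : Set M) (ζ : MForm 𝓘(ℝ, EM) M ℂ (d + 1))
      (κ' : MForm 𝓘(ℝ, EP (tupleSupport J)) (P (tupleSupport J)) ℂ d),
      IsOpen V ∧ V ⊆ T.V1 η st (d + 1) J ∧ (∀ y, T.emb (tupleSupport J) y ∈ V) ∧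
      ζ ∈ localClosedForms 𝓘(ℝ, EM) ℂ (d + 1) V ∧ IsSmoothForm κ' ∧
      T.srho ζ J = T.lam2 η st (d + 1) J + mextDeriv κ' := by
  obtain ⟨he, hV, hVf, hl⟩ := h
  obtain ⟨V, hV', hVV, hfV, ζ, hζ, κ', hκ', hex⟩ :=
    exists_nhd_pullback_eq_add_mextDeriv_complex (T.contMDiff_emb _) he hV
      (by rintro _ ⟨y, rfl⟩; exact hVf y) hl
  exact ⟨V, ζ, κ', hV', hVV, fun y ↦ hfV (mem_range_self y), hζ, hκ', hex⟩

variable {T η} in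
/-- T2 at level `n + 1`, form degree `0`. [cite: Bredon1997, II.10.6] -/
theorem T2Hyp.exists_zero {n : ℕ} {st : LevelData EM M EP P n} {J : Fin (n + 2) → ι}
    (h : T.T2Hyp η st 0 J) :
    ∃ (V : Set M) (ζ : MForm 𝓘(ℝ, EM) M ℂ 0), IsOpen V ∧ V ⊆ T.V1 η st 0 J ∧
      (∀ y, T.emb (tupleSupport J) y ∈ V) ∧ ζ ∈ localClosedForms 𝓘(ℝ, EM) ℂ 0 V ∧
      T.srho ζ J = T.lam2 η st 0 J := by
  obtain ⟨he, hV, hVf, hl⟩ := h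
  obtain ⟨V, hV', hVV, hfV, ζ, hζ, hex⟩ :=
    exists_nhd_pullback_eq_complex (T.contMDiff_emb _) he hV (by rintro _ ⟨y, rfl⟩; exact hVf y) hl
  exact ⟨V, ζ, hV', hVV, fun y ↦ hfV (mem_range_self y), hζ, hex⟩

open Classical in
/-- The neighbourhood produced by T2 (or `V1` if T2 does not apply). [folklore] -/
def V2 {n : ℕ} (st : LevelData EM M EP P n) : (b : ℕ) → (Fin (n + 2) → ι) → Set M
  | 0, J => if h : T.T2Hyp η st 0 J then h.exists_zero.choose else T.V1 η st 0 J
  | d + 1, J => if h : T.T2Hyp η st (d + 1) J then h.exists_succ.choose else T.V1 η st (d + 1) J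

open Classical in
/-- The closed correction produced by T2 (or `0`). [folklore] -/
def ζ2 {n : ℕ} (st : LevelData EM M EP P n) : (b : ℕ) → (J : Fin (n + 2) → ι) → MForm 𝓘(ℝ, EM) M ℂ b
  | 0, J => if h : T.T2Hyp η st 0 J then h.exists_zero.choose_spec.choose else 0
  | d + 1, J => if h : T.T2Hyp η st (d + 1) J then h.exists_succ.choose_spec.choose else 0

open Classical in
/-- The strata correction produced by T2 (or `0`). [folklore] -/
def κ2 {n : ℕ} (st : LevelData EM M EP P n) (d : ℕ) (J : Fin (n + 2) → ι) :
    MForm 𝓘(ℝ, EP (tupleSupport J)) (P (tupleSupport J)) ℂ d :=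
  if h : T.T2Hyp η st (d + 1) J then h.exists_succ.choose_spec.choose_spec.choose else 0

/-- The defining properties of `V2`, `ζ2`, `κ2` in positive degree when T2 applies. [folklore] -/
theorem V2_spec_succ {n : ℕ} {st : LevelData EM M EP P n} {d : ℕ} {J : Fin (n + 2) → ι}
    (h : T.T2Hyp η st (d + 1) J) :
    IsOpen (T.V2 η st (d + 1) J) ∧ T.V2 η st (d + 1) J ⊆ T.V1 η st (d + 1) J ∧
      (∀ y, T.emb (tupleSupport J) y ∈ T.V2 η st (d + 1) J) ∧
      T.ζ2 η st (d + 1) J ∈ localClosedForms 𝓘(ℝ, EM) ℂ (d + 1) (T.V2 η st (d + 1) J) ∧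
      IsSmoothForm (T.κ2 η st d J) ∧
      T.srho (T.ζ2 η st (d + 1) J) J = T.lam2 η st (d + 1) J + mextDeriv (T.κ2 η st d J) := by
  simp only [V2, ζ2, κ2, dif_pos h]
  exact h.exists_succ.choose_spec.choose_spec.choose_spec

/-- The defining properties of `V2`, `ζ2` in degree `0` when T2 applies. [folklore] -/
theorem V2_spec_zero {n : ℕ} {st : LevelData EM M EP P n} {J : Fin (n + 2) → ι}
    (h : T.T2Hyp η st 0 J) :
    IsOpen (T.V2 η st 0 J) ∧ T.V2 η st 0 J ⊆ T.V1 η st 0 J ∧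
      (∀ y, T.emb (tupleSupport J) y ∈ T.V2 η st 0 J) ∧
      T.ζ2 η st 0 J ∈ localClosedForms 𝓘(ℝ, EM) ℂ 0 (T.V2 η st 0 J) ∧
      T.srho (T.ζ2 η st 0 J) J = T.lam2 η st 0 J := by
  simp only [V2, ζ2, dif_pos h]
  exact h.exists_zero.choose_spec.choose_spec

/-- `V2`, `ζ2` when T2 does not apply. [folklore] -/
theorem V2_of_not {n : ℕ} {st : LevelData EM M EP P n} {b : ℕ} {J : Fin (n + 2) → ι}
    (h : ¬T.T2Hyp η st b J) : T.V2 η st b J = T.V1 η st b J ∧ T.ζ2 η st b J = 0 := by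
  cases b <;> simp only [V2, ζ2, dif_neg h, and_self]

/-- `κ2` when T2 does not apply. [folklore] -/
theorem κ2_of_not {n : ℕ} {st : LevelData EM M EP P n} {d : ℕ} {J : Fin (n + 2) → ι}
    (h : ¬T.T2Hyp η st (d + 1) J) : T.κ2 η st d J = 0 := by
  simp only [κ2, dif_neg h]

/-- **The next neighbourhoods** `N_{n+1} J = W_J ∩ ⋂_{b ≤ k+1} V²_J(b)`. [cite: BottTu1982Forms, Prop. 8.8] -/
def Nnext {n : ℕ} (st : LevelData EM M EP P n) (J : Fin (n + 2) → ι) : Set M :=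
  st.W J ∩ ⋂ b ∈ Finset.range (k + 2), T.V2 η st b J

/-- **The descent step** `n ↦ n + 1`. [cite: BottTu1982Forms, Prop. 8.8] -/
def step {n : ℕ} (st : LevelData EM M EP P n) : LevelData EM M EP P (n + 1) where
  N := T.Nnext η k st
  γ b J := ((-1 : ℂ) ^ n • T.g1 η st b J - T.ζ2 η st b J).restr (T.Nnext η k st J)
  κ d J := (-1 : ℂ) ^ n • T.κ2 η st d J

/-! #### Unconditional properties of the step -/

/-- `V¹ ⊆ W`. [folklore] -/
theorem V1_subset_W {n : ℕ} (st : LevelData EM M EP P n) (b : ℕ) (J : Fin (n + 2) → ι) :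
    T.V1 η st b J ⊆ st.W J := by
  by_cases h : T.T1Hyp η st b J
  · exact (T.V1_spec η h).2.1
  · rw [(T.V1_of_not η h).1]

/-- `V² ⊆ V¹`. [folklore] -/
theorem V2_subset_V1 {n : ℕ} (st : LevelData EM M EP P n) (b : ℕ) (J : Fin (n + 2) → ι) :
    T.V2 η st b J ⊆ T.V1 η st b J := by
  by_cases h : T.T2Hyp η st b J
  · cases b with
    | zero => exact (T.V2_spec_zero η h).2.1
    | succ d => exact (T.V2_spec_succ η h).2.1
  · rw [(T.V2_of_not η h).1]

/-- `V¹` is open when `W` is. [folklore] -/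
theorem isOpen_V1 {n : ℕ} {st : LevelData EM M EP P n} (b : ℕ) {J : Fin (n + 2) → ι}
    (hW : IsOpen (st.W J)) : IsOpen (T.V1 η st b J) := by
  by_cases h : T.T1Hyp η st b J
  · exact (T.V1_spec η h).1
  · rw [(T.V1_of_not η h).1]; exact hW

/-- `V²` is open when `W` is. [folklore] -/
theorem isOpen_V2 {n : ℕ} {st : LevelData EM M EP P n} (b : ℕ) {J : Fin (n + 2) → ι}
    (hW : IsOpen (st.W J)) : IsOpen (T.V2 η st b J) := by
  by_cases h : T.T2Hyp η st b J
  · cases b with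
    | zero => exact (T.V2_spec_zero η h).1
    | succ d => exact (T.V2_spec_succ η h).1
  · rw [(T.V2_of_not η h).1]; exact T.isOpen_V1 η b hW

/-- `emb_J` lands in `V¹` when it lands in `W`. [folklore] -/
theorem emb_mem_V1 {n : ℕ} {st : LevelData EM M EP P n} (b : ℕ) {J : Fin (n + 2) → ι}
    (hW : ∀ y, T.emb (tupleSupport J) y ∈ st.W J) (y : P (tupleSupport J)) :
    T.emb (tupleSupport J) y ∈ T.V1 η st b J := by
  by_cases h : T.T1Hyp η st b J
  · exact (T.V1_spec η h).2.2.1 y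
  · rw [(T.V1_of_not η h).1]; exact hW y

/-- `emb_J` lands in `V²` when it lands in `W`. [folklore] -/
theorem emb_mem_V2 {n : ℕ} {st : LevelData EM M EP P n} (b : ℕ) {J : Fin (n + 2) → ι}
    (hW : ∀ y, T.emb (tupleSupport J) y ∈ st.W J) (y : P (tupleSupport J)) :
    T.emb (tupleSupport J) y ∈ T.V2 η st b J := by
  by_cases h : T.T2Hyp η st b J
  · cases b with
    | zero => exact (T.V2_spec_zero η h).2.2.1 y
    | succ d => exact (T.V2_spec_succ η h).2.2.1 y
  · rw [(T.V2_of_not η h).1]; exact T.emb_mem_V1 η b hW y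

/-- The T1 primitive is smooth at the points of `V¹`. [folklore] -/
theorem g1_smoothAt {n : ℕ} (st : LevelData EM M EP P n) (b : ℕ) (J : Fin (n + 2) → ι) {y : M}
    (hy : y ∈ T.V1 η st b J) : (T.g1 η st b J).SmoothAt y := by
  by_cases h : T.T1Hyp η st b J
  · exact (T.V1_spec η h).2.2.2.1.1 y hy
  · rw [(T.V1_of_not η h).2]; exact MForm.smoothAt_zero y

/-- The T2 correction is smooth and closed at the points of `V²`. [folklore] -/
theorem ζ2_smoothAt {n : ℕ} (st : LevelData EM M EP P n) (b : ℕ) (J : Fin (n + 2) → ι) {y : M}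
    (hy : y ∈ T.V2 η st b J) : (T.ζ2 η st b J).SmoothAt y ∧ mextDeriv (T.ζ2 η st b J) y = 0 := by
  by_cases h : T.T2Hyp η st b J
  · cases b with
    | zero => exact ⟨(T.V2_spec_zero η h).2.2.2.1.1.1 y hy, (T.V2_spec_zero η h).2.2.2.1.2 y hy⟩
    | succ d => exact ⟨(T.V2_spec_succ η h).2.2.2.1.1.1 y hy, (T.V2_spec_succ η h).2.2.2.1.2 y hy⟩
  · rw [(T.V2_of_not η h).2, mextDeriv_zero]; exact ⟨MForm.smoothAt_zero y, rfl⟩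

/-- The T2 strata correction is smooth. [folklore] -/
theorem κ2_smooth {n : ℕ} (st : LevelData EM M EP P n) (d : ℕ) (J : Fin (n + 2) → ι) :
    IsSmoothForm (T.κ2 η st d J) := by
  by_cases h : T.T2Hyp η st (d + 1) J
  · exact (T.V2_spec_succ η h).2.2.2.2.1
  · rw [T.κ2_of_not η h]; exact isSmoothForm_zero

/-- `N_{n+1} J ⊆ W_J`. [folklore] -/
theorem Nnext_subset_W {n : ℕ} (st : LevelData EM M EP P n) (J : Fin (n + 2) → ι) :
    T.Nnext η k st J ⊆ st.W J :=
  inter_subset_left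

/-- `N_{n+1} J ⊆ V²_J(b)` for `b ≤ k + 1`. [folklore] -/
theorem Nnext_subset_V2 {n : ℕ} (st : LevelData EM M EP P n) {b : ℕ} (hb : b ≤ k + 1)
    (J : Fin (n + 2) → ι) : T.Nnext η k st J ⊆ T.V2 η st b J := fun y hy ↦ by
  have := hy.2
  rw [mem_iInter₂] at this
  exact this b (Finset.mem_range.2 (by omega))

/-- The next neighbourhoods decrease along faces: `N_{n+1} J ⊆ N_n (J ∘ σ_j)`. [folklore] -/
theorem step_N_subset {n : ℕ} (st : LevelData EM M EP P n) (J : Fin (n + 2) → ι) (j : Fin (n + 2)) :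
    (T.step η k st).N J ⊆ st.N (J ∘ Fin.succAbove j) :=
  (T.Nnext_subset_W η k st J).trans (iInter_subset _ j)

/-- `N_{n+1} J` is open. [folklore] -/
theorem isOpen_Nnext {n : ℕ} {st : LevelData EM M EP P n} (hN : ∀ J', IsOpen (st.N J'))
    (J : Fin (n + 2) → ι) : IsOpen (T.Nnext η k st J) := by
  have hW : IsOpen (st.W J) := isOpen_iInter_of_finite fun j ↦ hN _
  exact hW.inter (isOpen_biInter_finset fun b _ ↦ T.isOpen_V2 η b hW)

/-- `emb_J` lands in `N_{n+1} J`. [folklore] -/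
theorem emb_mem_Nnext {n : ℕ} {st : LevelData EM M EP P n}
    (hN : ∀ J' y, T.emb (tupleSupport J') y ∈ st.N J') (J : Fin (n + 2) → ι)
    (y : P (tupleSupport J)) : T.emb (tupleSupport J) y ∈ T.Nnext η k st J :=
  ⟨T.emb_mem_W hN J y, mem_iInter₂.2 fun b _ ↦ T.emb_mem_V2 η b (T.emb_mem_W hN J) y⟩

/-! ### §3 The invariants and the conditional properties of the step -/

omit [FiniteDimensional ℂ EM] [IsManifold 𝓘(ℝ, EM) ∞ M] [CompactSpace M] [T2Space M]
  [SecondCountableTopology M] [∀ I, FiniteDimensional ℂ (EP I)] [∀ I, IsManifold 𝓘(ℝ, EP I) ∞ (P I)]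
  [∀ I, CompactSpace (P I)] [∀ I, T2Space (P I)] [∀ I, SecondCountableTopology (P I)] in
/-- `δ` is compatible with subtraction. [folklore] -/
theorem delta_sub {a b : ℕ} (c c' : SCochain EP P a b) : T.delta (c - c') = T.delta c - T.delta c' := by
  rw [sub_eq_add_neg, delta_add, delta_neg, ← sub_eq_add_neg]

/-- **The invariants of the descent at level `n`**: the `N J` are open neighbourhoods of the
`emb (P_J)`; `γ_b` is smooth on `N` (`b ≤ k + 1`); the `κ` are smooth; the DEFECT EQUATION
`δ(emb^* γ_n - η_n - (-1)^n d κ_n) = 0` in the meaningful degree `n + b = k + 1`; and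
`δ γ_n` is closed on the intersections `W_J`. [cite: BottTu1982Forms, Prop. 8.8] -/
structure Good {n : ℕ} (st : LevelData EM M EP P n) : Prop where
  isOpen : ∀ J, IsOpen (st.N J)
  emb_mem : ∀ J y, T.emb (tupleSupport J) y ∈ st.N J
  smooth : ∀ b ≤ k + 1, ∀ J, st.γ b J ∈ smoothFormsOn 𝓘(ℝ, EM) ℂ (st.N J) b
  κ_smooth : ∀ d J, IsSmoothForm (st.κ d J)
  defect : ∀ b, n + b = k + 1 →
    T.delta (fun J ↦ T.srho (st.γ b J) J - η n b J - (-1 : ℂ) ^ n • kapD st.κ b J) = 0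
  closed : ∀ b, n + b = k + 1 → ∀ (J : Fin (n + 2) → ι), ∀ y ∈ st.W J,
    mextDeriv (cdelta (st.W J) (st.γ b) J) y = 0

section Step

variable {T η k}
  (hTe : ∀ I, IsEmbedding (T.emb I)) (hηs : ∀ a b J, IsSmoothForm (η a b J))
  (hηE : ∀ a b, a + b = k → ∀ J : Fin (a + 2) → ι,
    T.delta (η a (b + 1)) J + (-1 : ℂ) ^ (a + 1) • mextDeriv (η (a + 1) b J) = 0)
include hTe hηs hηE

omit [FiniteDimensional ℂ EM] [IsManifold 𝓘(ℝ, EM) ∞ M] [CompactSpace M] [T2Space M]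
  [SecondCountableTopology M] [∀ I, FiniteDimensional ℂ (EP I)] [∀ I, CompactSpace (P I)]
  [∀ I, T2Space (P I)] [∀ I, SecondCountableTopology (P I)] in
/-- **T1 applies at the next level**: `δ γ_n` is closed near `emb (P_J)` and
`emb_J^*(δ γ_n)_J = d λ¹_J` (from the defect equation, the strata equation
`δ η_n = (-1)^n d η_{n+1}` and `d δ = δ d`). [cite: BottTu1982Forms, Prop. 8.8] -/
theorem Good.t1Hyp {n : ℕ} {st : LevelData EM M EP P n} (hst : T.Good η k st) {b : ℕ}
    (hb : n + 1 + b = k + 1) (J : Fin (n + 2) → ι) : T.T1Hyp η st b J := by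
  have hW : IsOpen (st.W J) := isOpen_iInter_of_finite fun j ↦ hst.isOpen _
  have hWf : ∀ y, T.emb (tupleSupport J) y ∈ st.W J := T.emb_mem_W hst.emb_mem J
  have hκs : ∀ J', IsSmoothForm (st.κ b J') := fun J' ↦ hst.κ_smooth b J'
  refine ⟨hTe _, hW, hWf, ⟨cdelta_mem_smoothFormsOn hW J (fun j ↦ iInter_subset _ j)
    (fun j ↦ hst.smooth (b + 1) (by omega) _), fun y hy ↦ hst.closed (b + 1) (by omega) J y hy⟩,
    ((hηs _ _ _).add (T.isSmoothForm_delta hκs J)).smul_complex _, ?_⟩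
  have e1 : T.delta (fun J' ↦ T.srho (st.γ (b + 1) J') J') J =
      T.delta (η n (b + 1)) J + (-1 : ℂ) ^ n • T.delta (kapD st.κ (b + 1)) J := by
    have h0 := congrFun (hst.defect (b + 1) (by omega)) J
    have : (fun J' ↦ T.srho (st.γ (b + 1) J') J' - η n (b + 1) J' -
        (-1 : ℂ) ^ n • kapD st.κ (b + 1) J') =
        (fun J' ↦ T.srho (st.γ (b + 1) J') J') - η n (b + 1) - (-1 : ℂ) ^ n • kapD st.κ (b + 1) :=
      rfl
    rw [this, delta_sub, delta_sub, delta_smul, Pi.sub_apply, Pi.sub_apply, Pi.smul_apply,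
      Pi.zero_apply, sub_sub, sub_eq_zero] at h0
    exact h0
  have e2 : T.delta (η n (b + 1)) J = (-1 : ℂ) ^ n • mextDeriv (η (n + 1) b J) := by
    have h0 := hηE n b (by omega) J
    rw [add_eq_zero_iff_eq_neg] at h0
    rw [h0, pow_succ, mul_neg_one, neg_smul, neg_neg]
  have e3 : T.delta (kapD st.κ (b + 1)) J = mextDeriv (T.delta (st.κ b) J) := by
    rw [T.mextDeriv_delta hκs]; rfl
  rw [T.srho_cdelta _ J hWf, e1, e2, e3, lam1, mextDeriv_smul_complex_holds,
    mextDeriv_add (hηs _ _ _) (T.isSmoothForm_delta hκs J), smul_add]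

/-- `emb_J^*(d g_J) = d λ¹_J` for the T1 primitive `g_J`. [folklore] -/
theorem Good.srho_mextDeriv_g1 {n : ℕ} {st : LevelData EM M EP P n} (hst : T.Good η k st) {b : ℕ}
    (hb : n + 1 + b = k + 1) (J : Fin (n + 2) → ι) :
    T.srho (mextDeriv (T.g1 η st b J)) J = mextDeriv (T.lam1 η st b J) := by
  have h1 := hst.t1Hyp hTe hηs hηE hb J
  obtain ⟨-, -, hVf, -, hdg⟩ := T.V1_spec η h1
  rw [srho, ← MForm.pullback_restr_of_forall_mem hVf, hdg, MForm.pullback_restr_of_forall_mem hVf]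
  exact h1.2.2.2.2.2

/-- **T2 applies at the next level**: the defect `λ²_J` is smooth and closed on `P_J`.
[cite: BottTu1982Forms, Prop. 8.8] -/
theorem Good.t2Hyp {n : ℕ} {st : LevelData EM M EP P n} (hst : T.Good η k st) {b : ℕ}
    (hb : n + 1 + b = k + 1) (J : Fin (n + 2) → ι) : T.T2Hyp η st b J := by
  have h1 := hst.t1Hyp hTe hηs hηE hb J
  obtain ⟨hV, -, hVf, hg, -⟩ := T.V1_spec η h1
  have hκs : ∀ J', IsSmoothForm (st.κ b J') := fun J' ↦ hst.κ_smooth b J'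
  have hsg : (-1 : ℂ) ^ n • T.g1 η st b J ∈ smoothFormsOn 𝓘(ℝ, EM) ℂ (T.V1 η st b J) b :=
    smul_complex_mem_smoothFormsOn _ hg
  have hA : IsSmoothForm (T.srho ((-1 : ℂ) ^ n • T.g1 η st b J) J) :=
    isSmoothForm_pullback_of_mem_smoothFormsOn hsg (T.contMDiff_emb _) hVf
  have hB : IsSmoothForm (η (n + 1) b J) := hηs _ _ _
  have hC : IsSmoothForm (T.delta (st.κ b) J) := T.isSmoothForm_delta hκs J
  refine ⟨hTe _, hV, hVf, (hA.sub' hB).sub' hC, ?_⟩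
  have hdA : mextDeriv (T.srho ((-1 : ℂ) ^ n • T.g1 η st b J) J) =
      mextDeriv (η (n + 1) b J + T.delta (st.κ b) J) := by
    rw [srho, mextDeriv_pullback_of_mem_smoothFormsOn hsg (T.contMDiff_emb _) hVf,
      mextDeriv_smul_complex_holds, pullback_csmul, ← srho, hst.srho_mextDeriv_g1 hTe hηs hηE hb J,
      lam1, mextDeriv_smul_complex_holds, smul_smul, ← pow_add, ← two_mul, pow_mul, neg_one_sq,
      one_pow, one_smul]
  rw [IsClosedForm, lam2, mextDeriv_sub' (hA.sub' hB) hC, mextDeriv_sub' hA hB, hdA,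
    mextDeriv_add hB hC]
  abel

/-- **The equation `d γ_{n+1} = (-1)^n δ γ_n` at the points of `N_{n+1} J`.**
[cite: BottTu1982Forms, Prop. 8.8] -/
theorem Good.mextDeriv_step_γ_apply {n : ℕ} {st : LevelData EM M EP P n} (hst : T.Good η k st)
    {b : ℕ} (hb : n + 1 + b = k + 1) (J : Fin (n + 2) → ι) {y : M} (hy : y ∈ T.Nnext η k st J) :
    mextDeriv ((T.step η k st).γ b J) y =
      (-1 : ℂ) ^ n • cdelta (T.Nnext η k st J) (st.γ (b + 1)) J y := by
  have h1 := hst.t1Hyp hTe hηs hηE hb J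
  obtain ⟨-, -, -, -, hdg⟩ := T.V1_spec η h1
  have hN : IsOpen (T.Nnext η k st J) := T.isOpen_Nnext η k hst.isOpen J
  have hy2 : y ∈ T.V2 η st b J := T.Nnext_subset_V2 η k st (by omega) J hy
  have hy1 : y ∈ T.V1 η st b J := T.V2_subset_V1 η st b J hy2
  have hgs : ((-1 : ℂ) ^ n • T.g1 η st b J).SmoothAt y := (T.g1_smoothAt η st b J hy1).smul_complex _
  change mextDeriv (((-1 : ℂ) ^ n • T.g1 η st b J - T.ζ2 η st b J).restr (T.Nnext η k st J)) y = _
  rw [mextDeriv_restr_apply hN _ hy, mextDeriv_sub_apply hgs (T.ζ2_smoothAt η st b J hy2).1,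
    (T.ζ2_smoothAt η st b J hy2).2, sub_zero, mextDeriv_smul_complex_holds, Pi.smul_apply]
  have e : mextDeriv (T.g1 η st b J) y = cdelta (st.W J) (st.γ (b + 1)) J y := by
    have := congrFun hdg y
    rwa [MForm.restr_apply_of_mem _ hy1, MForm.restr_apply_of_mem _ hy1] at this
  rw [e, cdelta_apply_of_mem _ J (T.Nnext_subset_W η k st J hy), cdelta_apply_of_mem _ J hy]

/-- **The Čech–de Rham equation between levels `n` and `n + 1`**:
`(δ γ_n)_J + (-1)^{n+1} d γ_{n+1,J} = 0` on `N_{n+1} J` (as forms cut off to `N_{n+1} J`).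
[cite: BottTu1982Forms, Prop. 8.8] -/
theorem Good.cdelta_add_smul_mextDeriv_step {n : ℕ} {st : LevelData EM M EP P n}
    (hst : T.Good η k st) {b : ℕ} (hb : n + 1 + b = k + 1) (J : Fin (n + 2) → ι) :
    cdelta ((T.step η k st).N J) (st.γ (b + 1)) J +
      (-1 : ℂ) ^ (n + 1) • (mextDeriv ((T.step η k st).γ b J)).restr ((T.step η k st).N J) = 0 := by
  funext y
  rw [Pi.add_apply, Pi.smul_apply, Pi.zero_apply]
  by_cases hy : y ∈ T.Nnext η k st J
  · change cdelta (T.Nnext η k st J) (st.γ (b + 1)) J y +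
      (-1 : ℂ) ^ (n + 1) • (mextDeriv ((T.step η k st).γ b J)).restr (T.Nnext η k st J) y = 0
    rw [MForm.restr_apply_of_mem _ hy, hst.mextDeriv_step_γ_apply hTe hηs hηE hb J hy, smul_smul,
      neg_one_pow_succ_mul_neg_one_pow, neg_one_smul, add_neg_cancel]
  · change cdelta (T.Nnext η k st J) (st.γ (b + 1)) J y +
      (-1 : ℂ) ^ (n + 1) • (mextDeriv ((T.step η k st).γ b J)).restr (T.Nnext η k st J) y = 0
    rw [MForm.restr_apply_of_notMem _ hy, cdelta_apply_of_notMem _ J hy, smul_zero, add_zero]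

/-- **The invariants propagate.** [cite: BottTu1982Forms, Prop. 8.8] -/
theorem Good.step {n : ℕ} {st : LevelData EM M EP P n} (hst : T.Good η k st) :
    T.Good η k (T.step η k st) where
  isOpen J := T.isOpen_Nnext η k hst.isOpen J
  emb_mem J y := T.emb_mem_Nnext η k hst.emb_mem J y
  smooth b hb J := by
    have hN : IsOpen (T.Nnext η k st J) := T.isOpen_Nnext η k hst.isOpen J
    refine ⟨fun y hy ↦ (MForm.smoothAt_restr_iff hN _ hy).2 ?_, fun y hy ↦ MForm.restr_apply_of_notMem _ hy⟩
    have hy2 : y ∈ T.V2 η st b J := T.Nnext_subset_V2 η k st hb J hy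
    exact ((T.g1_smoothAt η st b J (T.V2_subset_V1 η st b J hy2)).smul_complex _).sub
      (T.ζ2_smoothAt η st b J hy2).1
  κ_smooth d J := (T.κ2_smooth η st d J).smul_complex _
  defect b hb := by
    have key : (fun J ↦ T.srho ((T.step η k st).γ b J) J - η (n + 1) b J -
        (-1 : ℂ) ^ (n + 1) • kapD (T.step η k st).κ b J) = T.delta (st.κ b) := by
      funext J
      have h2 := hst.t2Hyp hTe hηs hηE hb J
      have hρ : T.srho ((T.step η k st).γ b J) J =
          T.srho ((-1 : ℂ) ^ n • T.g1 η st b J) J - T.srho (T.ζ2 η st b J) J := by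
        change T.srho (((-1 : ℂ) ^ n • T.g1 η st b J - T.ζ2 η st b J).restr (T.Nnext η k st J)) J = _
        rw [srho, MForm.pullback_restr_of_forall_mem (T.emb_mem_Nnext η k hst.emb_mem J),
          MForm.pullback_sub']
        rfl
      rw [hρ]
      cases b with
      | zero =>
        obtain ⟨-, -, -, -, hζ⟩ := T.V2_spec_zero η h2
        rw [hζ, lam2]
        change _ - _ - (-1 : ℂ) ^ (n + 1) • (0 : MForm _ _ ℂ 0) = _
        rw [smul_zero, sub_zero]
        abel
      | succ d =>
        obtain ⟨-, -, -, -, -, hζ⟩ := T.V2_spec_succ η h2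
        rw [hζ, lam2]
        change _ - _ - (-1 : ℂ) ^ (n + 1) • mextDeriv ((-1 : ℂ) ^ n • T.κ2 η st d J) = _
        rw [mextDeriv_smul_complex_holds, smul_smul, neg_one_pow_succ_mul_neg_one_pow, neg_one_smul]
        abel
    rw [key, delta_delta]
  closed b hb J y hy := by
    have hW' : IsOpen ((T.step η k st).W J) :=
      isOpen_iInter_of_finite fun i ↦ T.isOpen_Nnext η k hst.isOpen _
    have hyi : ∀ i, y ∈ T.Nnext η k st (J ∘ Fin.succAbove i) := fun i ↦ mem_iInter.1 hy i
    have hsm : ∀ i, ((T.step η k st).γ b (J ∘ Fin.succAbove i)).SmoothAt y := by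
      intro i
      have hN : IsOpen (T.Nnext η k st (J ∘ Fin.succAbove i)) := T.isOpen_Nnext η k hst.isOpen _
      have hy2 : y ∈ T.V2 η st b (J ∘ Fin.succAbove i) := T.Nnext_subset_V2 η k st (by omega) _ (hyi i)
      exact (MForm.smoothAt_restr_iff hN _ (hyi i)).2
        (((T.g1_smoothAt η st b _ (T.V2_subset_V1 η st b _ hy2)).smul_complex _).sub
          (T.ζ2_smoothAt η st b _ hy2).1)
    rw [mextDeriv_cdelta_apply hW' _ J hy hsm]
    have : ∀ i : Fin (n + 3), (-1 : ℂ) ^ (i : ℕ) • mextDeriv ((T.step η k st).γ b (J ∘ Fin.succAbove i)) y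
        = (-1 : ℂ) ^ n • ((-1 : ℂ) ^ (i : ℕ) •
          cdelta (T.Nnext η k st (J ∘ Fin.succAbove i)) (st.γ (b + 1)) (J ∘ Fin.succAbove i) y) := by
      intro i
      rw [hst.mextDeriv_step_γ_apply hTe hηs hηE hb _ (hyi i), smul_comm]
    simp_rw [this]
    rw [← smul_sum, ← cdelta_apply_of_mem (fun J' ↦ cdelta (T.Nnext η k st J') (st.γ (b + 1)) J') J hy,
      cdelta_cdelta_apply _ J hy hyi, smul_zero]

end Step

/-! ### §4 Level `0`, the recursion, the last level, and the export -/

section Init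

variable (x : (q : ℕ) → MForm 𝓘(ℝ, EM) M ℂ q)

/-- The hypotheses under which T1 is invoked at level `0` (tuple `(i)`, form degree `b`; the
meaningful degree is `b = k + 1`, where they say `d η_{(i)} = emb^* x`). [cite: Bredon1997, II.10.6] -/
def T1Hyp₀ (b : ℕ) (J : Fin 1 → ι) : Prop :=
  IsEmbedding (T.emb (tupleSupport J)) ∧
    x (b + 1) ∈ localClosedForms 𝓘(ℝ, EM) ℂ (b + 1) (univ : Set M) ∧
    IsSmoothForm (η 0 b J) ∧ T.srho (x (b + 1)) J = mextDeriv (η 0 b J)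

variable {T η x} in
/-- T1 at level `0`. [cite: Bredon1997, II.10.6] [cite: Spanier1981, Ch. 6 §1, Thm. 10] -/
theorem T1Hyp₀.exists {b : ℕ} {J : Fin 1 → ι} (h : T.T1Hyp₀ η x b J) :
    ∃ (V : Set M) (g : MForm 𝓘(ℝ, EM) M ℂ b), IsOpen V ∧ (∀ y, T.emb (tupleSupport J) y ∈ V) ∧
      g ∈ smoothFormsOn 𝓘(ℝ, EM) ℂ V b ∧ (mextDeriv g).restr V = (x (b + 1)).restr V := by
  obtain ⟨he, hc, hl, hd⟩ := h
  obtain ⟨V, hV, -, hfV, hex⟩ :=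
    exists_nhd_restr_mem_localExactForms_of_pullback_eq_mextDeriv_complex (T.contMDiff_emb _) he
      isOpen_univ (fun y ↦ mem_univ _) hc hl hd
  obtain ⟨β, hβ⟩ := (mem_localExactForms_succ_iff hV).1 hex
  exact ⟨V, β, hV, fun y ↦ hfV (mem_range_self y), β.2, by rw [← hβ, coe_localD]⟩

open Classical in
/-- The neighbourhood produced by T1 at level `0` (or `univ`). [folklore] -/
def V1₀ (b : ℕ) (J : Fin 1 → ι) : Set M :=
  if h : T.T1Hyp₀ η x b J then h.exists.choose else univ

open Classical in
/-- The primitive produced by T1 at level `0` (or `0`). [folklore] -/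
def g1₀ (b : ℕ) (J : Fin 1 → ι) : MForm 𝓘(ℝ, EM) M ℂ b :=
  if h : T.T1Hyp₀ η x b J then h.exists.choose_spec.choose else 0

/-- The defining properties of `V1₀`, `g1₀` when T1 applies. [folklore] -/
theorem V1₀_spec {b : ℕ} {J : Fin 1 → ι} (h : T.T1Hyp₀ η x b J) :
    IsOpen (T.V1₀ η x b J) ∧ (∀ y, T.emb (tupleSupport J) y ∈ T.V1₀ η x b J) ∧
      T.g1₀ η x b J ∈ smoothFormsOn 𝓘(ℝ, EM) ℂ (T.V1₀ η x b J) b ∧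
      (mextDeriv (T.g1₀ η x b J)).restr (T.V1₀ η x b J) = (x (b + 1)).restr (T.V1₀ η x b J) := by
  simp only [V1₀, g1₀, dif_pos h]
  exact h.exists.choose_spec.choose_spec

/-- `V1₀`, `g1₀` when T1 does not apply. [folklore] -/
theorem V1₀_of_not {b : ℕ} {J : Fin 1 → ι} (h : ¬T.T1Hyp₀ η x b J) :
    T.V1₀ η x b J = univ ∧ T.g1₀ η x b J = 0 := by
  simp only [V1₀, g1₀, dif_neg h, and_self]

/-- The defect at level `0`: `λ²_{(i)} = emb^* g_{(i)} - η_{(i)}`. [cite: BottTu1982Forms, Prop. 8.8] -/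
def lam2₀ (b : ℕ) (J : Fin 1 → ι) : MForm 𝓘(ℝ, EP (tupleSupport J)) (P (tupleSupport J)) ℂ b :=
  T.srho (T.g1₀ η x b J) J - η 0 b J

/-- The hypotheses under which T2 is invoked at level `0`. [cite: Bredon1997, II.10.6] -/
def T2Hyp₀ (b : ℕ) (J : Fin 1 → ι) : Prop :=
  IsEmbedding (T.emb (tupleSupport J)) ∧ IsOpen (T.V1₀ η x b J) ∧
    (∀ y, T.emb (tupleSupport J) y ∈ T.V1₀ η x b J) ∧
    T.lam2₀ η x b J ∈ closedSmoothForms 𝓘(ℝ, EP (tupleSupport J)) (P (tupleSupport J)) ℂ b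

variable {T η x} in
/-- T2 at level `0`, positive degree. [cite: Bredon1997, II.10.6] -/
theorem T2Hyp₀.exists_succ {d : ℕ} {J : Fin 1 → ι} (h : T.T2Hyp₀ η x (d + 1) J) :
    ∃ (V : Set M) (ζ : MForm 𝓘(ℝ, EM) M ℂ (d + 1))
      (κ' : MForm 𝓘(ℝ, EP (tupleSupport J)) (P (tupleSupport J)) ℂ d),
      IsOpen V ∧ V ⊆ T.V1₀ η x (d + 1) J ∧ (∀ y, T.emb (tupleSupport J) y ∈ V) ∧
      ζ ∈ localClosedForms 𝓘(ℝ, EM) ℂ (d + 1) V ∧ IsSmoothForm κ' ∧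
      T.srho ζ J = T.lam2₀ η x (d + 1) J + mextDeriv κ' := by
  obtain ⟨he, hV, hVf, hl⟩ := h
  obtain ⟨V, hV', hVV, hfV, ζ, hζ, κ', hκ', hex⟩ :=
    exists_nhd_pullback_eq_add_mextDeriv_complex (T.contMDiff_emb _) he hV
      (by rintro _ ⟨y, rfl⟩; exact hVf y) hl
  exact ⟨V, ζ, κ', hV', hVV, fun y ↦ hfV (mem_range_self y), hζ, hκ', hex⟩

variable {T η x} in
/-- T2 at level `0`, degree `0`. [cite: Bredon1997, II.10.6] -/
theorem T2Hyp₀.exists_zero {J : Fin 1 → ι} (h : T.T2Hyp₀ η x 0 J) :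
    ∃ (V : Set M) (ζ : MForm 𝓘(ℝ, EM) M ℂ 0), IsOpen V ∧ V ⊆ T.V1₀ η x 0 J ∧
      (∀ y, T.emb (tupleSupport J) y ∈ V) ∧ ζ ∈ localClosedForms 𝓘(ℝ, EM) ℂ 0 V ∧
      T.srho ζ J = T.lam2₀ η x 0 J := by
  obtain ⟨he, hV, hVf, hl⟩ := h
  obtain ⟨V, hV', hVV, hfV, ζ, hζ, hex⟩ :=
    exists_nhd_pullback_eq_complex (T.contMDiff_emb _) he hV (by rintro _ ⟨y, rfl⟩; exact hVf y) hl
  exact ⟨V, ζ, hV', hVV, fun y ↦ hfV (mem_range_self y), hζ, hex⟩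

open Classical in
/-- The neighbourhood produced by T2 at level `0` (or `V1₀`). [folklore] -/
def V2₀ : (b : ℕ) → (Fin 1 → ι) → Set M
  | 0, J => if h : T.T2Hyp₀ η x 0 J then h.exists_zero.choose else T.V1₀ η x 0 J
  | d + 1, J => if h : T.T2Hyp₀ η x (d + 1) J then h.exists_succ.choose else T.V1₀ η x (d + 1) J

open Classical in
/-- The closed correction produced by T2 at level `0` (or `0`). [folklore] -/
def ζ2₀ : (b : ℕ) → (J : Fin 1 → ι) → MForm 𝓘(ℝ, EM) M ℂ b
  | 0, J => if h : T.T2Hyp₀ η x 0 J then h.exists_zero.choose_spec.choose else 0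
  | d + 1, J => if h : T.T2Hyp₀ η x (d + 1) J then h.exists_succ.choose_spec.choose else 0

open Classical in
/-- The strata correction produced by T2 at level `0` (or `0`). [folklore] -/
def κ2₀ (d : ℕ) (J : Fin 1 → ι) : MForm 𝓘(ℝ, EP (tupleSupport J)) (P (tupleSupport J)) ℂ d :=
  if h : T.T2Hyp₀ η x (d + 1) J then h.exists_succ.choose_spec.choose_spec.choose else 0

/-- The defining properties of `V2₀`, `ζ2₀`, `κ2₀` in positive degree when T2 applies. [folklore] -/
theorem V2₀_spec_succ {d : ℕ} {J : Fin 1 → ι} (h : T.T2Hyp₀ η x (d + 1) J) :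
    IsOpen (T.V2₀ η x (d + 1) J) ∧ T.V2₀ η x (d + 1) J ⊆ T.V1₀ η x (d + 1) J ∧
      (∀ y, T.emb (tupleSupport J) y ∈ T.V2₀ η x (d + 1) J) ∧
      T.ζ2₀ η x (d + 1) J ∈ localClosedForms 𝓘(ℝ, EM) ℂ (d + 1) (T.V2₀ η x (d + 1) J) ∧
      IsSmoothForm (T.κ2₀ η x d J) ∧
      T.srho (T.ζ2₀ η x (d + 1) J) J = T.lam2₀ η x (d + 1) J + mextDeriv (T.κ2₀ η x d J) := by
  simp only [V2₀, ζ2₀, κ2₀, dif_pos h]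
  exact h.exists_succ.choose_spec.choose_spec.choose_spec

/-- The defining properties of `V2₀`, `ζ2₀` in degree `0` when T2 applies. [folklore] -/
theorem V2₀_spec_zero {J : Fin 1 → ι} (h : T.T2Hyp₀ η x 0 J) :
    IsOpen (T.V2₀ η x 0 J) ∧ T.V2₀ η x 0 J ⊆ T.V1₀ η x 0 J ∧
      (∀ y, T.emb (tupleSupport J) y ∈ T.V2₀ η x 0 J) ∧
      T.ζ2₀ η x 0 J ∈ localClosedForms 𝓘(ℝ, EM) ℂ 0 (T.V2₀ η x 0 J) ∧
      T.srho (T.ζ2₀ η x 0 J) J = T.lam2₀ η x 0 J := by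
  simp only [V2₀, ζ2₀, dif_pos h]
  exact h.exists_zero.choose_spec.choose_spec

/-- `V2₀`, `ζ2₀` when T2 does not apply. [folklore] -/
theorem V2₀_of_not {b : ℕ} {J : Fin 1 → ι} (h : ¬T.T2Hyp₀ η x b J) :
    T.V2₀ η x b J = T.V1₀ η x b J ∧ T.ζ2₀ η x b J = 0 := by
  cases b <;> simp only [V2₀, ζ2₀, dif_neg h, and_self]

/-- `κ2₀` when T2 does not apply. [folklore] -/
theorem κ2₀_of_not {d : ℕ} {J : Fin 1 → ι} (h : ¬T.T2Hyp₀ η x (d + 1) J) : T.κ2₀ η x d J = 0 := by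
  simp only [κ2₀, dif_neg h]

/-- The level-`0` neighbourhoods `N_0 (i) = ⋂_{b ≤ k+1} V²_{(i)}(b)`. [cite: BottTu1982Forms, Prop. 8.8] -/
def N₀ (J : Fin 1 → ι) : Set M :=
  ⋂ b ∈ Finset.range (k + 2), T.V2₀ η x b J

/-- **Level `0` of the descent.** [cite: BottTu1982Forms, Prop. 8.8] -/
def init : LevelData EM M EP P 0 where
  N := T.N₀ η k x
  γ b J := (T.g1₀ η x b J - T.ζ2₀ η x b J).restr (T.N₀ η k x J)
  κ d J := -T.κ2₀ η x d J

/-- `V1₀` is open. [folklore] -/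
theorem isOpen_V1₀ (b : ℕ) (J : Fin 1 → ι) : IsOpen (T.V1₀ η x b J) := by
  by_cases h : T.T1Hyp₀ η x b J
  · exact (T.V1₀_spec η x h).1
  · rw [(T.V1₀_of_not η x h).1]; exact isOpen_univ

/-- `V2₀` is open. [folklore] -/
theorem isOpen_V2₀ (b : ℕ) (J : Fin 1 → ι) : IsOpen (T.V2₀ η x b J) := by
  by_cases h : T.T2Hyp₀ η x b J
  · cases b with
    | zero => exact (T.V2₀_spec_zero η x h).1
    | succ d => exact (T.V2₀_spec_succ η x h).1
  · rw [(T.V2₀_of_not η x h).1]; exact T.isOpen_V1₀ η x b J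

/-- `emb_{(i)}` lands in `V1₀`. [folklore] -/
theorem emb_mem_V1₀ (b : ℕ) (J : Fin 1 → ι) (y : P (tupleSupport J)) :
    T.emb (tupleSupport J) y ∈ T.V1₀ η x b J := by
  by_cases h : T.T1Hyp₀ η x b J
  · exact (T.V1₀_spec η x h).2.1 y
  · rw [(T.V1₀_of_not η x h).1]; exact mem_univ _

/-- `emb_{(i)}` lands in `V2₀`. [folklore] -/
theorem emb_mem_V2₀ (b : ℕ) (J : Fin 1 → ι) (y : P (tupleSupport J)) :
    T.emb (tupleSupport J) y ∈ T.V2₀ η x b J := by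
  by_cases h : T.T2Hyp₀ η x b J
  · cases b with
    | zero => exact (T.V2₀_spec_zero η x h).2.2.1 y
    | succ d => exact (T.V2₀_spec_succ η x h).2.2.1 y
  · rw [(T.V2₀_of_not η x h).1]; exact T.emb_mem_V1₀ η x b J y

/-- `V2₀ ⊆ V1₀`. [folklore] -/
theorem V2₀_subset_V1₀ (b : ℕ) (J : Fin 1 → ι) : T.V2₀ η x b J ⊆ T.V1₀ η x b J := by
  by_cases h : T.T2Hyp₀ η x b J
  · cases b with
    | zero => exact (T.V2₀_spec_zero η x h).2.1
    | succ d => exact (T.V2₀_spec_succ η x h).2.1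
  · rw [(T.V2₀_of_not η x h).1]

/-- The level-`0` T1 primitive is smooth at the points of `V1₀`. [folklore] -/
theorem g1₀_smoothAt (b : ℕ) (J : Fin 1 → ι) {y : M} (hy : y ∈ T.V1₀ η x b J) :
    (T.g1₀ η x b J).SmoothAt y := by
  by_cases h : T.T1Hyp₀ η x b J
  · exact (T.V1₀_spec η x h).2.2.1.1 y hy
  · rw [(T.V1₀_of_not η x h).2]; exact MForm.smoothAt_zero y

/-- The level-`0` T2 correction is smooth and closed at the points of `V2₀`. [folklore] -/
theorem ζ2₀_smoothAt (b : ℕ) (J : Fin 1 → ι) {y : M} (hy : y ∈ T.V2₀ η x b J) :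
    (T.ζ2₀ η x b J).SmoothAt y ∧ mextDeriv (T.ζ2₀ η x b J) y = 0 := by
  by_cases h : T.T2Hyp₀ η x b J
  · cases b with
    | zero => exact ⟨(T.V2₀_spec_zero η x h).2.2.2.1.1.1 y hy, (T.V2₀_spec_zero η x h).2.2.2.1.2 y hy⟩
    | succ d => exact ⟨(T.V2₀_spec_succ η x h).2.2.2.1.1.1 y hy, (T.V2₀_spec_succ η x h).2.2.2.1.2 y hy⟩
  · rw [(T.V2₀_of_not η x h).2, mextDeriv_zero]; exact ⟨MForm.smoothAt_zero y, rfl⟩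

/-- The level-`0` T2 strata correction is smooth. [folklore] -/
theorem κ2₀_smooth (d : ℕ) (J : Fin 1 → ι) : IsSmoothForm (T.κ2₀ η x d J) := by
  by_cases h : T.T2Hyp₀ η x (d + 1) J
  · exact (T.V2₀_spec_succ η x h).2.2.2.2.1
  · rw [T.κ2₀_of_not η x h]; exact isSmoothForm_zero

/-- `N_0 (i)` is open. [folklore] -/
theorem isOpen_N₀ (J : Fin 1 → ι) : IsOpen (T.N₀ η k x J) :=
  isOpen_biInter_finset fun b _ ↦ T.isOpen_V2₀ η x b J

/-- `N_0 (i) ⊆ V2₀ (i)(b)` for `b ≤ k + 1`. [folklore] -/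
theorem N₀_subset_V2₀ {b : ℕ} (hb : b ≤ k + 1) (J : Fin 1 → ι) : T.N₀ η k x J ⊆ T.V2₀ η x b J :=
  fun y hy ↦ by
    rw [N₀, mem_iInter₂] at hy
    exact hy b (Finset.mem_range.2 (by omega))

/-- `emb_{(i)}` lands in `N_0 (i)`. [folklore] -/
theorem emb_mem_N₀ (J : Fin 1 → ι) (y : P (tupleSupport J)) : T.emb (tupleSupport J) y ∈ T.N₀ η k x J :=
  mem_iInter₂.2 fun b _ ↦ T.emb_mem_V2₀ η x b J y

section InitGood

variable {T η k x}
  (hTe : ∀ I, IsEmbedding (T.emb I)) (hηs : ∀ a b J, IsSmoothForm (η a b J))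
  (hx : x (k + 2) ∈ closedSmoothForms 𝓘(ℝ, EM) M ℂ (k + 2))
  (hη0 : ∀ J : Fin 1 → ι, mextDeriv (η 0 (k + 1) J) = T.sres (x (k + 2)) J)
include hTe hηs hx hη0

omit [FiniteDimensional ℂ EM] [IsManifold 𝓘(ℝ, EM) ∞ M] [CompactSpace M] [T2Space M]
  [SecondCountableTopology M] [∀ I, FiniteDimensional ℂ (EP I)] [∀ I, IsManifold 𝓘(ℝ, EP I) ∞ (P I)]
  [∀ I, CompactSpace (P I)] [∀ I, T2Space (P I)] [∀ I, SecondCountableTopology (P I)] in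
/-- T1 applies at level `0` in the meaningful degree. [folklore] -/
theorem t1Hyp₀ (J : Fin 1 → ι) : T.T1Hyp₀ η x (k + 1) J :=
  ⟨hTe _, mem_localClosedForms_univ_of_mem_closedSmoothForms hx, hηs _ _ _, (hη0 J).symm⟩

/-- `emb^*(d g_{(i)}) = d η_{(i)}` for the level-`0` primitive. [folklore] -/
theorem srho_mextDeriv_g1₀ (J : Fin 1 → ι) :
    T.srho (mextDeriv (T.g1₀ η x (k + 1) J)) J = mextDeriv (η 0 (k + 1) J) := by
  have h1 := t1Hyp₀ hTe hηs hx hη0 J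
  obtain ⟨-, hVf, -, hdg⟩ := T.V1₀_spec η x h1
  rw [srho, ← MForm.pullback_restr_of_forall_mem hVf, hdg, MForm.pullback_restr_of_forall_mem hVf]
  exact h1.2.2.2

/-- T2 applies at level `0` in the meaningful degree. [folklore] -/
theorem t2Hyp₀ (J : Fin 1 → ι) : T.T2Hyp₀ η x (k + 1) J := by
  have h1 := t1Hyp₀ hTe hηs hx hη0 J
  obtain ⟨hV, hVf, hg, -⟩ := T.V1₀_spec η x h1
  have hA : IsSmoothForm (T.srho (T.g1₀ η x (k + 1) J) J) :=
    isSmoothForm_pullback_of_mem_smoothFormsOn hg (T.contMDiff_emb _) hVf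
  have hB : IsSmoothForm (η 0 (k + 1) J) := hηs _ _ _
  refine ⟨hTe _, hV, hVf, hA.sub' hB, ?_⟩
  rw [IsClosedForm, lam2₀, mextDeriv_sub' hA hB, srho,
    mextDeriv_pullback_of_mem_smoothFormsOn hg (T.contMDiff_emb _) hVf, ← srho,
    srho_mextDeriv_g1₀ hTe hηs hx hη0 J, sub_self]

/-- **`d γ_{(i)} = x` at the points of `N_0 (i)`.** [cite: BottTu1982Forms, Prop. 8.8] -/
theorem mextDeriv_init_γ_apply (J : Fin 1 → ι) {y : M} (hy : y ∈ T.N₀ η k x J) :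
    mextDeriv ((T.init η k x).γ (k + 1) J) y = x (k + 2) y := by
  have h1 := t1Hyp₀ hTe hηs hx hη0 J
  obtain ⟨-, -, -, hdg⟩ := T.V1₀_spec η x h1
  have hN : IsOpen (T.N₀ η k x J) := T.isOpen_N₀ η k x J
  have hy2 : y ∈ T.V2₀ η x (k + 1) J := T.N₀_subset_V2₀ η k x le_rfl J hy
  have hy1 : y ∈ T.V1₀ η x (k + 1) J := T.V2₀_subset_V1₀ η x _ J hy2
  change mextDeriv ((T.g1₀ η x (k + 1) J - T.ζ2₀ η x (k + 1) J).restr (T.N₀ η k x J)) y = _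
  rw [mextDeriv_restr_apply hN _ hy,
    mextDeriv_sub_apply (T.g1₀_smoothAt η x _ J hy1) (T.ζ2₀_smoothAt η x _ J hy2).1,
    (T.ζ2₀_smoothAt η x _ J hy2).2, sub_zero]
  have := congrFun hdg y
  rwa [MForm.restr_apply_of_mem _ hy1, MForm.restr_apply_of_mem _ hy1] at this

/-- **The invariants hold at level `0`.** [cite: BottTu1982Forms, Prop. 8.8] -/
theorem good_init : T.Good η k (T.init η k x) where
  isOpen J := T.isOpen_N₀ η k x J
  emb_mem J y := T.emb_mem_N₀ η k x J y
  smooth b hb J := by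
    refine ⟨fun y hy ↦ (MForm.smoothAt_restr_iff (T.isOpen_N₀ η k x J) _ hy).2 ?_,
      fun y hy ↦ MForm.restr_apply_of_notMem _ hy⟩
    have hy2 : y ∈ T.V2₀ η x b J := T.N₀_subset_V2₀ η k x hb J hy
    exact (T.g1₀_smoothAt η x b J (T.V2₀_subset_V1₀ η x b J hy2)).sub (T.ζ2₀_smoothAt η x b J hy2).1
  κ_smooth d J := (T.κ2₀_smooth η x d J).neg'
  defect b hb := by
    obtain rfl : b = k + 1 := by omega
    have key : (fun J ↦ T.srho ((T.init η k x).γ (k + 1) J) J - η 0 (k + 1) J -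
        (-1 : ℂ) ^ 0 • kapD (T.init η k x).κ (k + 1) J) = 0 := by
      funext J
      have h2 := t2Hyp₀ hTe hηs hx hη0 J
      obtain ⟨-, -, -, -, -, hζ⟩ := T.V2₀_spec_succ η x h2
      have hρ : T.srho ((T.init η k x).γ (k + 1) J) J =
          T.srho (T.g1₀ η x (k + 1) J) J - T.srho (T.ζ2₀ η x (k + 1) J) J := by
        change T.srho ((T.g1₀ η x (k + 1) J - T.ζ2₀ η x (k + 1) J).restr (T.N₀ η k x J)) J = _
        rw [srho, MForm.pullback_restr_of_forall_mem (T.emb_mem_N₀ η k x J), MForm.pullback_sub']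
        rfl
      rw [hρ, hζ, lam2₀, pow_zero, one_smul, Pi.zero_apply]
      change _ - _ - mextDeriv (-T.κ2₀ η x k J) = 0
      rw [mextDeriv_neg]
      abel
    rw [key, delta_zero]
  closed b hb J y hy := by
    obtain rfl : b = k + 1 := by omega
    have hW : IsOpen ((T.init η k x).W J) := isOpen_iInter_of_finite fun i ↦ T.isOpen_N₀ η k x _
    have hyi : ∀ i, y ∈ T.N₀ η k x (J ∘ Fin.succAbove i) := fun i ↦ mem_iInter.1 hy i
    have hsm : ∀ i, ((T.init η k x).γ (k + 1) (J ∘ Fin.succAbove i)).SmoothAt y := by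
      intro i
      have hy2 : y ∈ T.V2₀ η x (k + 1) (J ∘ Fin.succAbove i) := T.N₀_subset_V2₀ η k x le_rfl _ (hyi i)
      exact (MForm.smoothAt_restr_iff (T.isOpen_N₀ η k x _) _ (hyi i)).2
        ((T.g1₀_smoothAt η x _ _ (T.V2₀_subset_V1₀ η x _ _ hy2)).sub (T.ζ2₀_smoothAt η x _ _ hy2).1)
    rw [mextDeriv_cdelta_apply hW _ J hy hsm, Fin.sum_univ_two]
    simp only [Fin.val_zero, pow_zero, one_smul, Fin.val_one, pow_one, neg_one_smul]
    rw [mextDeriv_init_γ_apply hTe hηs hx hη0 _ (hyi 0), mextDeriv_init_γ_apply hTe hηs hx hη0 _ (hyi 1),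
      add_neg_cancel]

end InitGood

/-- **All the levels of the descent**, by recursion. [cite: BottTu1982Forms, Prop. 8.8] -/
def levels : (n : ℕ) → LevelData EM M EP P n
  | 0 => T.init η k x
  | n + 1 => T.step η k (levels n)

/-- Level `0` of the recursion. [folklore] -/
theorem levels_zero : T.levels η k x 0 = T.init η k x := rfl

/-- The successor levels of the recursion. [folklore] -/
theorem levels_succ (n : ℕ) : T.levels η k x (n + 1) = T.step η k (T.levels η k x n) := rfl

end Init

section Export

variable {T η k} {x : (q : ℕ) → MForm 𝓘(ℝ, EM) M ℂ q}
  (hTe : ∀ I, IsEmbedding (T.emb I)) (hηs : ∀ a b J, IsSmoothForm (η a b J))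
  (hηE : ∀ a b, a + b = k → ∀ J : Fin (a + 2) → ι,
    T.delta (η a (b + 1)) J + (-1 : ℂ) ^ (a + 1) • mextDeriv (η (a + 1) b J) = 0)
  (hx : x (k + 2) ∈ closedSmoothForms 𝓘(ℝ, EM) M ℂ (k + 2))
  (hη0 : ∀ J : Fin 1 → ι, mextDeriv (η 0 (k + 1) J) = T.sres (x (k + 2)) J)
include hTe hηs hηE hx hη0

/-- The invariants hold at every level. [cite: BottTu1982Forms, Prop. 8.8] -/
theorem good_levels : ∀ n, T.Good η k (T.levels η k x n)
  | 0 => good_init hTe hηs hx hη0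
  | n + 1 => (good_levels n).step hTe hηs hηE

/-- **The last level**: `(δ γ_{k+1})_J`, a `δ`-cocycle of locally constant functions near
`emb (P_J)` with vanishing pull-back (`η_{k+1} = 0` in form degree `0`), vanishes on a smaller
neighbourhood (T1 in degree `0`). [cite: BottTu1982Forms, Prop. 8.8] [cite: Bredon1997, II.10.6] -/
theorem exists_last (hηz : ∀ J : Fin (k + 2) → ι, η (k + 1) 0 J = 0) (J : Fin (k + 3) → ι) :
    ∃ V : Set M, IsOpen V ∧ V ⊆ (T.levels η k x (k + 1)).W J ∧
      (∀ y, T.emb (tupleSupport J) y ∈ V) ∧ cdelta V ((T.levels η k x (k + 1)).γ 0) J = 0 := by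
  have hst := good_levels hTe hηs hηE hx hη0 (k + 1)
  set st := T.levels η k x (k + 1)
  have hW : IsOpen (st.W J) := isOpen_iInter_of_finite fun j ↦ hst.isOpen _
  have hWf : ∀ y, T.emb (tupleSupport J) y ∈ st.W J := T.emb_mem_W hst.emb_mem J
  have hc : cdelta (st.W J) (st.γ 0) J ∈ localClosedForms 𝓘(ℝ, EM) ℂ 0 (st.W J) :=
    ⟨cdelta_mem_smoothFormsOn hW J (fun j ↦ iInter_subset _ j) (fun j ↦ hst.smooth 0 (by omega) _),
      fun y hy ↦ hst.closed 0 (by omega) J y hy⟩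
  have hρ : T.srho (cdelta (st.W J) (st.γ 0) J) J = 0 := by
    rw [T.srho_cdelta _ J hWf]
    have h0 := congrFun (hst.defect 0 (by omega)) J
    have : (fun J' ↦ T.srho (st.γ 0 J') J' - η (k + 1) 0 J' - (-1 : ℂ) ^ (k + 1) • kapD st.κ 0 J') =
        fun J' ↦ T.srho (st.γ 0 J') J' := by
      funext J'
      rw [hηz J']
      change _ - 0 - (-1 : ℂ) ^ (k + 1) • (0 : MForm _ _ ℂ 0) = _
      rw [smul_zero, sub_zero, sub_zero]
    rwa [this] at h0
  obtain ⟨V, hV, hVW, hfV, h0⟩ :=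
    exists_nhd_restr_eq_zero_of_pullback_eq_zero_complex (T.contMDiff_emb _) (hTe _) hW hWf hc hρ
  exact ⟨V, hV, hVW, fun y ↦ hfV (mem_range_self y), by rw [← cdelta_restr hVW, h0]⟩

/-- **Descent of the strata cochain to neighbourhoods (Bott–Tu (1982), Prop. 8.8, made
effective).** Given the strata `∂∂̄`-cochain `η` of a smooth closed complex `(k+2)`-form `x`
(`d η_{(i)} = emb^* x`, `δ η_a + (-1)^{a+1} d η_{a+1} = 0` on `a + b = k`, `η = 0` in form degree
`0` at level `k + 1`), there are open neighbourhoods `N n J ⊇ emb (P_J)` of the strata of all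
tuples of length `n + 1 ≤ k + 2`, decreasing along faces, ambient forms `γ n b J` smooth on
`N n J`, and open sets `V J ⊇ emb (P_J)` for the tuples of length `k + 3`, such that
`d γ_{(i)} = x` on `N 0 (i)`, `(δ γ_n)_J + (-1)^{n+1} d γ_{n+1,J} = 0` on `N (n+1) J`
(`n + 1 + b = k + 1`), and `(δ γ_{k+1})_J = 0` on `V J`.
[cite: BottTu1982Forms, §8, Prop. 8.8] [cite: Bredon1997, II.10.6] -/
theorem exists_nbhd_descent (hηz : ∀ J : Fin (k + 2) → ι, η (k + 1) 0 J = 0) :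
    ∃ (N : (n : ℕ) → (Fin (n + 1) → ι) → Set M) (γ : (n b : ℕ) → MCochain ι EM M n b)
      (V : (Fin (k + 3) → ι) → Set M),
      (∀ n J, IsOpen (N n J)) ∧ (∀ n J y, T.emb (tupleSupport J) y ∈ N n J) ∧
      (∀ n (J : Fin (n + 2) → ι) j, N (n + 1) J ⊆ N n (J ∘ Fin.succAbove j)) ∧
      (∀ n, ∀ b ≤ k + 1, ∀ J, γ n b J ∈ smoothFormsOn 𝓘(ℝ, EM) ℂ (N n J) b) ∧
      (∀ (J : Fin 1 → ι), ∀ y ∈ N 0 J, mextDeriv (γ 0 (k + 1) J) y = x (k + 2) y) ∧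
      (∀ n b, n + 1 + b = k + 1 → ∀ J : Fin (n + 2) → ι,
        cdelta (N (n + 1) J) (γ n (b + 1)) J +
          (-1 : ℂ) ^ (n + 1) • (mextDeriv (γ (n + 1) b J)).restr (N (n + 1) J) = 0) ∧
      (∀ J, IsOpen (V J) ∧ (∀ j, V J ⊆ N (k + 1) (J ∘ Fin.succAbove j)) ∧
        (∀ y, T.emb (tupleSupport J) y ∈ V J) ∧ cdelta (V J) (γ (k + 1) 0) J = 0) := by
  have hgood := good_levels hTe hηs hηE hx hη0
  refine ⟨fun n ↦ (T.levels η k x n).N, fun n ↦ (T.levels η k x n).γ,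
    fun J ↦ (exists_last hTe hηs hηE hx hη0 hηz J).choose,
    fun n J ↦ (hgood n).isOpen J, fun n J y ↦ (hgood n).emb_mem J y,
    fun n J j ↦ T.step_N_subset η k _ J j, fun n b hb J ↦ (hgood n).smooth b hb J,
    fun J y hy ↦ mextDeriv_init_γ_apply hTe hηs hx hη0 J hy,
    fun n b hb J ↦ (hgood n).cdelta_add_smul_mextDeriv_step hTe hηs hηE hb J, fun J ↦ ?_⟩
  obtain ⟨hV, hVW, hfV, h0⟩ := (exists_last hTe hηs hηE hx hη0 hηz J).choose_spec
  exact ⟨hV, fun j ↦ hVW.trans (iInter_subset _ j), hfV, h0⟩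

end Export

end StrataMaps

end Descent

end Literature.Geometry.Kaehler

end
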